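import Literature.MathematicalPhysics.KineticTheory.HardSphereEuler
import Literature.MathematicalPhysics.KineticTheory.HardSphereEulerDim
import Literature.MathematicalPhysics.KineticTheory.FouriersLaw
import Literature.MathematicalPhysics.StatisticalMechanics.Crystallization
import Literature.MathematicalPhysics.QuantumManyBody.BoseEinsteinCondensation
import Literature.MathematicalPhysics.QuantumManyBody.ThermalExpectation
import HarnessLib
import HarnessLib.Audit
import HarnessLib.Audit.TribunalTags

/-!
# Strong-Hypothesis Library — summit `AtomisticToContinuum` (D-0034, skeleton)

The REGISTRY of known strong hypotheses `H` (open statements with `H ⇒ P` landed or printed) and of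
known EQUIVALENT REFORMULATIONS `E` for the four problems of the summit
`AtomisticToContinuum := HydrodynamicLimit ∧ FouriersLaw ∧ Crystallization ∧ BoseEinsteinCondensation`
(`Summits/AtomisticToContinuum/Statement.lean`):

* `HydrodynamicLimit` (`Summits/AtomisticToContinuum/HydrodynamicLimit/Statement.lean`, a root `def`; tag key
  `"AtomisticToContinuum.HydrodynamicLimit"`): the PACKING-GUARDED hydrodynamic limit — compressible Euler up
  to the first shock from deterministic hard spheres on `𝕋³` at fixed positive reduced density, local-Gibbs
  data, convergence in probability of the empirical fields, for solutions with `ρ_t(x)σ³ < η₀`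
  (Spohn 1991 Part I Ch. 3; verbatim `HydroLimitInBandDim 3`, `hydroLimitInBandDim_three_iff_root`).
* `FouriersLaw` (`abbrev FouriersLaw : Prop := Literature.MathematicalPhysics.KineticTheory.HeatConduction.FouriersLaw`;
  key `"AtomisticToContinuum.FouriersLaw"`): for the pinned anharmonic chain `pinnedChain ω₂ lam β γ`
  between Langevin baths, NESS existence/uniqueness and `κ(T) = lim_N N lim_{δT→0} J_N/δT ∈ (0, ∞)`
  (Bonetto–Lebowitz–Rey-Bellet 2000, §5.3 (33)).
* `Crystallization` (`abbrev Crystallization : Prop := Literature.MathematicalPhysics.StatisticalMechanics.Crystallization`;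
  key `"AtomisticToContinuum.Crystallization"`): Lennard-Jones in `ℝ³` —
  `HasPeriodicGroundStateEnergy lennardJones 3 ∧ IsCrystallizing lennardJones 3` (Blanc–Lewin 2015 §2.1).
* `BoseEinsteinCondensation` (`abbrev … := Literature.MathematicalPhysics.QuantumManyBody.BoseGas.BoseEinsteinCondensation`;
  key `"AtomisticToContinuum.BoseEinsteinCondensation"`): ground-state BEC `λ_max(γ⁽¹⁾) ≥ cN` in the
  thermodynamic limit at every small density, for every repulsive finite-range radial pair potential
  (LSSY 2005 §1.2 (1.19), Ch. 5).

Every entry carries `@[strong_hypothesis "AtomisticToContinuum.<P>"]`; bridges live summit-side in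
`Summits/AtomisticToContinuum/StrongHypotheses.lean`.

## The honest shape of this summit's library

All four problems are DERIVATION problems (a continuum law from a fixed microscopic model). In print
their "stronger hypotheses" are almost always INPUTS of a method (macro-ergodicity, relative-entropy
bounds, a-priori spectral gaps) rather than statements known to imply the conclusion, and the equivalent
reformulations live summit-side as route cruxes (`Theses` decls, never tagged). What survives: one
existing Literature conjecture (the unguarded hydrodynamic limit) and two newly stated, trivially typeable
BEC strengthenings; everything else is censused below with the reason it is not registered.

## Census

| # | `H` / `E` | one-line statement | relation | source | status here | bridge |
|---|---|---|---|---|---|---|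
| H1 | `Literature.MathematicalPhysics.KineticTheory.HydrodynamicLimit` | the UNGUARDED hard-sphere Euler limit: `∃ σ₀` before `∀ T ∀ (ρ,u,θ)`, no packing guard | strictly stronger than `HydrodynamicLimit` (drops the guard `ρ_t(x)σ³ < η₀`) | Spohn 1991, Part I Ch. 3 (§3.2 (3.21), §3.3) | registered (existing def, tagged below). CAVEAT: the 2026-08-16 re-type (D-0032) moved the summit OFF this form because its typing covers imploding solutions reaching close packing; it is not refuted in tree, but a route proving `¬H` would make its probes vacuous — untag then | landed: `_root_.HydrodynamicLimit.of_unguarded` (summit file `hydrodynamicLimit_of_unguarded`) |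
| H2 | `HydroLimitInBandDim d` / `HydrodynamicLimitDim d` (`HardSphereEulerDim.lean`) | the `d`-dimensional lifts | `d = 3` instances: equivalent (`hydroLimitInBandDim_three_iff_root`) / strictly stronger (`hydrodynamicLimitDim_three_iff` ∘ H1) | Spohn 1991 Part I Ch. 3 | PARAMETRISED predicates (in `d`), not closed `Prop`s; the all-`d` closure is not posed in print and would include `d = 1` (hard rods: integrable, generalized hydrodynamics — the 3-law Euler system is the wrong limit), so no closure is stated | none (instances only) |
| H3 | Yau relative-entropy hypothesis: `N⁻¹ H(f_t^N ∣ local Gibbs(ρ_t,u_t,θ_t)) → 0` on `[0,T)` for the deterministic flow | the standard intermediate that implies the LLN of the conserved fields | stronger (relative entropy ⇒ convergence in probability: Yau 1991, OVY 1993 §1–§3) | Yau 1991; Olla–Varadhan–Yau 1993 §1 | not typeable as ONE closed `Prop` for the full problem: the tree has the specific relative entropy and the local Gibbs laws, but the time-`t` pushed-forward law of the hard-sphere flow relative to `localGibbsLaw` at the Euler profile is assembled only inside route files (`Theorems.NearConstantShortTimeHL.NearConstantRelEntropy`, near-constant short-time slice; route-internal, not tagged) | none |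
| H4 | `BGLEulerLimitConjecture d`, `TubeEulerLimit`, `deng_hani_ma_hilbert6` | Boltzmann-to-Euler (Boltzmann–Grad), quasi-1D tube analogue, Deng–Hani–Ma long-time Boltzmann–Grad | INCOMPARABLE (different scaling / geometry); no implication to fixed-density hard spheres in print | Bardos–Golse–Levermore; in-tree `HydrodynamicLimits.lean`, `TubeEuler.lean` | not registered | none |
| F1 | `Literature.Barriers.AtomisticToContinuum.MacroErgodicityHypothesis` | the infinite deterministic pinned chain is macro-ergodic (Bernardin 2014 Def. 1) | an INPUT of the entropy method, not known to imply Fourier's law (diffusive scaling for a deterministic chain is open even given it) | Bernardin 2014 §1.1; Fritz–Funaki–Lebowitz 1994 | not registered (registering an input as an implication would mis-teach the tribunal) | none |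
| F2 | BLR local-equilibrium form of Fourier's law: the NESS is locally Gibbs at a profile `T(x)` solving `(κ(T)T')' = 0`, `J_N ∼ −κ(T(x))T'(x)/N` | BLR 2000 §5.2–5.3 (30)–(32) | expected stronger than (33), but NO printed implication (32) ⇒ (33) (BLR pose both; (33) is our conjunct) | Bonetto–Lebowitz–Rey-Bellet 2000 §5 | candidate (not yet in tree): typeable over `OscillatorChain.IsSteadyState` with local marginals, > 15 lines | none |
| F3 | Green–Kubo: `κ_GK(T) = (1/T²)∫₀^∞ Σ_x ⟨j₀(0) j_x(t)⟩_T dt` converges and is in `(0,∞)` for the infinite pinned chain, and equals the NESS conductivity | BLR 2000 §6; Aoki–Lukkarinen–Spohn 2006 | linear-response EQUALITY with the NESS `κ` is itself conjectural — no implication in print | BLR 2000 §6.3 | not typeable (missing notion: infinite-volume equilibrium dynamics of `pinnedChain` and its current autocorrelation; the barrier files `AnticontinuumLocalization*` build infinite-chain dynamics only at strong pinning) | none |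
| F4 | summit-side conditional criteria `IncoherentChannel ↔ FouriersLaw`, `stub_varianceLimit ↔ FouriersLaw` GIVEN `stub_forecastLoss` | route PhononMeanFreePath / IncoherentChannel line census | conditional equivalences over an OPEN engine; the decls are `Theses` items / line stubs in a `Lines/` file with `sorry`s | in-tree `Cruxes/IncoherentChannel/Lines/two_horizons_forecast_loss.lean` | not registered (route cruxes; conditional; unbuilt-with-sorry) | none |
| C1 | `IsCrystallizing lennardJones 3` | Blanc–Lewin local convergence of LJ ground states alone | EQUIVALENT to `Crystallization` (it implies the energy statement): landed `_root_.Crystallization ↔ IsCrystallizing lennardJones 3` (`Cruxes/LJBarlowRigidity/LandedGlue.lean`, `SplitGlue.lean`) | Blanc–Lewin 2015 §2.1 (15)–(17) | an INSTANCE of the parametrised predicate `IsCrystallizing V d`, no decl to tag; not restated (CONVENTIONS §4) | landed as a theorem on the instance; nothing to tag |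
| C2 | HCP-specific crystallization: the local limits of LJ ground states are (dilated, rotated) hexagonal close packings with the optimal density | Blanc–Lewin 2015 §2.3 ("expected … hcp" for LJ; FCC vs HCP energy difference `∼ 0.01 %`) | strictly stronger than `Crystallization` (names the lattice) | Blanc–Lewin 2015 §2.3 | candidate (not yet in tree): the HCP configuration exists (`StatisticalMechanics/HcpHomogeneous.lean`, `HcpSiteGeometry.lean`) but "limit measure = HCP up to isometry and dilation" is > 15 lines | none (would be routine) |
| C3 | `Summit.AtomisticToContinuum.Crystallization.LennardJonesShellGapConjecture` | periodic first-shell energy gap for LJ on the `1/3`-hard-core class | EQUIVALENT to the route crux `Theses.PalmUnimodularRigidity.MinimiserShells` (landed `minimiserShells_iff_lennardJonesShellGapConjecture`); relation to `Crystallization` itself NOT established in either direction | in-tree `Theorems/PalmUnimodularRigidityMinimiserShellsShellGapConjecture.lean`; Blanc–Lewin 2015 §2.3 | not registered (a named route core, not a known-stronger hypothesis; tagging it would be the circularity the tribunal forbids) | none |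
| C4 | Cohn–Kumar universal optimality of a lattice in `d = 3` | every completely monotone potential of squared distance is minimised by one lattice | REFUTED as typed for lattices in `d = 3` (`Literature.Barriers.AtomisticToContinuum.NoUniversallyOptimalLattice3D`, discharged; FCC/BCC exchange under Gaussian potentials) and the LP bound is not sharp (`CohnElkiesNotSharp3D`) | Cohn–Kumar 2007 §9; in-tree barriers | not registered (a refutable `H` makes every probe vacuous) | none |
| C5 | finite-`N` exact crystallization (every LJ ground state in `ℝ³` is a subset of one dilated close packing) | Theil 2006 (`d = 2`), Flatley–Theil 2015 (`d = 3` WITH a three-body term) shape | would imply `Crystallization`; FALSE/unsupported for the pure two-body LJ potential (surface relaxation; Flatley–Theil need the three-body term) | Theil 2006; Flatley–Theil 2015; Blanc–Lewin 2015 §2.3 | not registered | none |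
| B1 | `CompleteCondensationDilute` (NEW, below) | 100 % condensation in the dilute limit: for every `ε ∈ (0,1)`, at all small densities `λ_max(γ_{Ψ₀}) ≥ (1 − ε)N` eventually | strictly stronger than `BoseEinsteinCondensation` (`ε = 1/2` gives `c = 1/2`) | LSSY 2005 §1.2 (1.19) and Ch. 5 (complete BEC is PROVED there only in the Gross–Pitaevskii limit, Thm 5.1; the thermodynamic-limit statement is the open strengthening predicted by Bogoliubov 1947 / Lee–Huang–Yang 1957, depletion `∼ (ρa³)^{1/2}`) | registered (new decl) | landed: `boseEinsteinCondensation_of_completeCondensationDilute` (summit file, 4 lines) |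
| B2 | `ThermalCondensationDilute` (NEW, below) | positive-temperature BEC: at every small density there is `β₀` with thermal zero-mode occupation `≥ cN` for all `β > β₀` (Dirichlet box, canonical state; `HasThermalZeroModeBEC`) | expected stronger in physics (`T > 0`); NO printed or landed implication to the ground-state statement in this typing (`β → ∞` limit of the canonical state is not in the tree) | LSSY 2005 §1.2 (1.19) ("immediately generalizes to thermal states"); Seiringer 2008 (free energy at `T > 0`; BEC at `T > 0` open) | registered (new decl) | none |
| B3 | Penrose–Onsager ODLRO / `Literature.MathematicalPhysics.QuantumManyBody.PenroseOnsager.HasBEC nM` | `n_M/N ↛ 0` for an occupation sequence | the 1956 criterion; parametrised by the sequence `nM`, no model attached | Penrose–Onsager 1956 | not registered (parametrised, model-free) | none |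
| B4 | Lee–Huang–Yang second-order ground-state energy asymptotics | `e(ρ) = 4πaρ(1 + (128/15√π)(ρa³)^{1/2} + o(√(ρa³)))` | a THEOREM (Yau–Yin 2009 upper, Fournais–Solovej 2020 lower) and it does NOT imply condensation (`Literature.Barriers.AtomisticToContinuum.EnergyAsymptoticsWithoutCondensation`) | Yau–Yin 2009; barrier file | not registered | none |

## Deliberately NOT registered (summary)

* Route cruxes / `Theses` decls and their proved equivalents (`MinimiserShells`, `LaminarBarlowWindows → Crystallization`,
  `BulkDefectVanish → Crystallization`, `IncoherentChannel`, `MacroClosure`, `ClampedEntropyClock`, the ~95 open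
  `Theorems.NearConstantShortTimeHL.*` / `ConeLocalisation.*` stubs of `HydrodynamicLimit`): probed, never tagged.
* Inputs-not-implications (F1, H3 as a method input), refuted or refutable statements (C4, C5, the all-`d` closure of H2),
  parametrised predicates without a printed closure (H2, B3, C1's `IsCrystallizing V d`, `OscillatorChain.FouriersLawFor P` —
  whose universal closure is FALSE: `not_forall_fouriersLawFor`, harmonic chains are ballistic).
* Theorems (OVY 1993 stochastic Euler limit, Theil 2006, Flatley–Theil 2015, LHY, Lieb–Seiringer 2002 GP-limit BEC,
  `deng_hani_ma_hilbert6`): not hypotheses.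

## Sources (keys in `lean/references.bib`)

[Spohn1991] Part I Ch. 3; [OllaVaradhanYau1993] §1; [Yau1991]; [BonettoLebowitzReyBellet2000] §5.2–5.3 (30)–(33), §6;
[AokiLukkarinenSpohn2006]; [Bernardin2014] §1.1; [BlancLewin2015] §2.1 (15)–(17), §2.3; [Theil2006]; [FlatleyTheil2015];
[LSSY2005] §1.2 (1.16)–(1.19), Ch. 5 Thm 5.1; [LiebSeiringer2002]; [Seiringer2008]; [YauYin2009].
-/

noncomputable section

open Filter
open scoped ENNReal

/-! ## Existing Literature conjecture `def`s, tagged in place (no restatement) -/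

attribute [strong_hypothesis "AtomisticToContinuum.HydrodynamicLimit"]
  Literature.MathematicalPhysics.KineticTheory.HydrodynamicLimit

namespace Literature.StrongHypotheses.AtomisticToContinuum

open Literature.MathematicalPhysics.QuantumManyBody.BoseGas

/-! ## `BoseEinsteinCondensation`: newly stated strengthenings -/

/-- OPEN CONJECTURE — **complete Bose–Einstein condensation of the dilute Bose gas in the thermodynamic
limit**: for every repulsive finite-range radial pair potential `v` and every `ε ∈ (0, 1)` there is
`ρ₀ > 0` such that at every density `0 < ρ < ρ₀` the ground state of `N` bosons in the Dirichlet box of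
side `(N/ρ)^{1/3}` has condensate occupation `λ_max(γ_{Ψ₀}) ≥ (1 − ε) N` for all large `N`
(`condensateNumber`, `sideLength` of `BoseEinsteinCondensation.lean`) — i.e. the condensate FRACTION
tends to `1` as `ρ → 0`, as predicted by Bogoliubov's 1947 theory (Lee–Huang–Yang depletion
`1 − λ_max/N ≈ (8/3√π)(ρa³)^{1/2}`). Lieb–Seiringer prove complete BEC in the Gross–Pitaevskii LIMIT
(LSSY 2005, Thm 5.1); in the thermodynamic limit at fixed small density even `λ_max ≥ cN` (the summit
conjunct, LSSY (1.19)) is open, and this statement is STRICTLY STRONGER (take `ε = 1/2`; bridge landed in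
the summit file). [cite: LSSY2005, §1.2 (1.19) and Ch. 5 Thm 5.1] [status: open] -/
@[conjecture, strong_hypothesis "AtomisticToContinuum.BoseEinsteinCondensation"]
def CompleteCondensationDilute : Prop :=
  ∀ v : ℝ → ℝ≥0∞, IsRepulsiveFiniteRange v →
    ∀ ε : ℝ, 0 < ε → ε < 1 →
      ∃ ρ₀ : ℝ, 0 < ρ₀ ∧ ∀ ρ : ℝ, 0 < ρ → ρ < ρ₀ →
        ∀ᶠ N : ℕ in atTop, ENNReal.ofReal ((1 - ε) * N) ≤ condensateNumber v N (sideLength ρ N)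

/-- OPEN CONJECTURE — **positive-temperature Bose–Einstein condensation of the dilute interacting gas**:
for every repulsive finite-range radial pair potential `v` there is `ρ₀ > 0` such that at every density
`0 < ρ < ρ₀` there is an inverse temperature `β₀ > 0` with: for all `β > β₀`, the canonical Gibbs state
of `N` bosons in the Dirichlet box of side `(N/ρ)^{1/3}` occupies the constant mode macroscopically,
`⟨φ₀, γ_β φ₀⟩ ≥ c N` for all large `N` (`HasThermalZeroModeBEC v ρ β`, LSSY's criterion (1.19) for thermal
states: "this concept of BEC … immediately generalizes to thermal states"). Open for every genuinely
interacting continuum model (only free-energy asymptotics are known at `T > 0`, Seiringer 2008). Expected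
to be harder than the ground-state statement, but NO implication to it is printed or landed in this typing
(the `β → ∞` limit of the canonical state is not in the tree): registered with bridge NONE.
[cite: LSSY2005, §1.2 (1.19)] [status: open] -/
@[conjecture, strong_hypothesis "AtomisticToContinuum.BoseEinsteinCondensation"]
def ThermalCondensationDilute : Prop :=
  ∀ v : ℝ → ℝ≥0∞, IsRepulsiveFiniteRange v →
    ∃ ρ₀ : ℝ, 0 < ρ₀ ∧ ∀ ρ : ℝ, 0 < ρ → ρ < ρ₀ →
      ∃ β₀ : ℝ, 0 < β₀ ∧ ∀ β : ℝ, β₀ < β → HasThermalZeroModeBEC v ρ β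

end Literature.StrongHypotheses.AtomisticToContinuum
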